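import Summits.CriticalPhenomena.PercolationContinuityZ3.Theorems.SahiMasterFamilyZeroFlagMinorF
import Summits.CriticalPhenomena.PercolationContinuityZ3.Theorems.SahiMasterFamilyFIneqAllThirdEvents
import HarnessLib

/-!
# The 0-minor side: `MD₃` whenever the two `0`-sections are independent and CROSS-ABSORBED by the third member's `1`-section

Unit `prim-master-conj` (crux anchor stmt-CriticalPhenomena-4575, helper work), gen 30; memo
`run/shared/lean/prim/prim-l12/prim-master-conj/POINTWISE.md` §31.  Supersedes the hypotheses of gen 20's `…ZeroFlagMinorF` /
bnk-2's `SahiFCombBridge.sahiE_three_ge_sq_minor` / this generation's `…ZeroFlagMinorFGeneral`: there the `0`-minor had to be a hull-`Ω`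
sandwich (`X ⊆ G`, `Y ⊆ G`); here NOTHING is assumed about the `0`-section `G` of the third member.

SETTING.  An increasing triple `U`, a coordinate `e`; `0`-sections `X, Y, G`, `1`-sections `A, B, C` (so `X ⊆ A`, `Y ⊆ B`, `G ⊆ C`).
HYPOTHESES: `μ_p(X ∩ Y) = μ_p(X)μ_p(Y)` and `X ∪ Y ⊆ C`.  (`U^{e←0} = (X,Y,G)` is then an "independent pair" triple, `E₃ ≥ 0`, but not a zero flag
in general; every hull-`K` sandwich `G = K ∩ G″`, `X∪Y ⊆ G″ ⊆ C`, is covered.)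

* `mixC2_sub_sahiE_eq_F_add_cross` — for ANY weight and any `P, Q` with `m(P₀P₁) = m(P₀)m(P₁)` only:
  **`Λ = F(Q₀,Q₁;Q₂) + (m(Q₀Q₂) − p₀)(m(Q₁Q₂) − p₁) + (1 − q₂)[m(Q₀Q₁Q₂) + p₀p₁ − p₀q₁ − p₁q₀] + (q₂ − p₂)(m(Q₀Q₁) − q₀q₁)`**
  **`      + q₁(p₀ − m(P₀P₂)) + q₀(p₁ − m(P₁P₂)) − 2(p₀p₁ − m(P₀P₁P₂))`**  (pure algebra).
* `sahiE_secAt_true_le_mixC2_cross` — for an increasing triple with `X ⟂ Y`, `X ∪ Y ⊆ C`: the bracket equals `μ(C∩(A∖X)∩(B∖Y)) + Cov(A,Y) + Cov(X,B)`,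
  the last line is `≥ 0` by Harris (`μ(XYG) ≥ μY·μ(XG)`, `≥ μX·μ(YG)`) and `μB ≥ μY`, `μA ≥ μX`; with THEOREM F: **`E₃(U^{e←1}) ≤ mixC2(U^{e←0},U^{e←1})`**,
  i.e. `Λ ≥ 0` — by gen 19's `sahiE_three_ge_sq_minors_of_mixC2_ge` this is MD₃ at `(U,e)`: `(1−p_e)²E₃(U^{e←0}) + p_e²E₃(U^{e←1}) ≤ E₃(U)`.
* **`dominatesMinors_cross`** — packaged as MINOR DOMINATION at `(U,e,p)` (the hypothesis of gen 15's class theorem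
  `sahiE_ind_nonneg_and_eq_zero_iff_on_class_of_minorDomination`), constants `(1−p_e)², p_e²`;
  `sahiE_three_secAt_false_nonneg_cross` (the `0`-minor is an independent-pair triple, `E₃ ≥ 0`);
  `sahiE_three_nonneg_and_secAt_true_eq_zero_cross` — `C₃` passes up from the `1`-minor and zeros pass down to it.
HONEST FRAMING: identity + Harris bookkeeping on top of THEOREM F.  What is still OPEN on the `0`-minor side: `X ⟂ Y` with `X ⊄ C¹` or `Y ⊄ C¹`
(e.g. hull-`K` sandwiches whose third `1`-section misses part of `X ∪ Y`; the sub-case where only one member depends on `e` is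
`…KahnAbsorbedProduct`).  Numerics first: `prim-master-conj/code-g30/d0cross.py` (450 exact instances, identity and signs). [this work]
-/

noncomputable section

open scoped Classical

namespace Summit.CriticalPhenomena.PercolationContinuityZ3.Theorems

open Finset Function
open Literature.Combinatorics.Sahi2008
open Literature.Probability.Percolation.DecisionTree (ind)
open SahiCombMix

namespace Pointwise

variable {ι : Type} [Fintype ι]

/-! ### 1. The identity with only `m(P₀P₁) = m(P₀)m(P₁)` -/

section Identity

variable (μ : Set ι → ℝ) (P Q : Fin 3 → Set (Set ι))
  (h1 : ex μ (ind (P 0) * ind (P 1)) = ex μ (ind (P 0)) * ex μ (ind (P 1)))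
include h1

/-- **`Λ = F + (m(AC)−x)(m(BC)−y) + (1−c)[m(ABC)+xy−xb−ya] + (c−g)(m(AB)−ab) + b(x−m(XG)) + a(y−m(YG)) − 2(xy−m(XYG))`**
(file header). [this work] -/
theorem mixC2_sub_sahiE_eq_F_add_cross :
    mixC2 μ P Q - sahiE μ 3 (fun j => ind (Q j))
      = ((1 + ex μ (ind (Q 2))) * ex μ (ind (Q 0) * ind (Q 1) * ind (Q 2))
            - ex μ (ind (Q 2)) * ex μ (ind (Q 0) * ind (Q 1))
            - ex μ (ind (Q 0) * ind (Q 2)) * ex μ (ind (Q 1) * ind (Q 2)))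
        + (ex μ (ind (Q 0) * ind (Q 2)) - ex μ (ind (P 0))) * (ex μ (ind (Q 1) * ind (Q 2)) - ex μ (ind (P 1)))
        + (1 - ex μ (ind (Q 2))) * (ex μ (ind (Q 0) * ind (Q 1) * ind (Q 2)) + ex μ (ind (P 0)) * ex μ (ind (P 1))
            - ex μ (ind (P 0)) * ex μ (ind (Q 1)) - ex μ (ind (P 1)) * ex μ (ind (Q 0)))
        + (ex μ (ind (Q 2)) - ex μ (ind (P 2))) * (ex μ (ind (Q 0) * ind (Q 1)) - ex μ (ind (Q 0)) * ex μ (ind (Q 1)))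
        + (ex μ (ind (Q 1)) * (ex μ (ind (P 0)) - ex μ (ind (P 0) * ind (P 2)))
            + ex μ (ind (Q 0)) * (ex μ (ind (P 1)) - ex μ (ind (P 1) * ind (P 2)))
            - 2 * (ex μ (ind (P 0)) * ex μ (ind (P 1)) - ex μ (ind (P 0) * ind (P 1) * ind (P 2)))) := by
  rw [mixC2, sahiE_three_apply]
  linear_combination (-(ex μ (ind (Q 2)))) * h1

end Identity

/-! ### 2. Cross-absorbed increasing triples -/

section Cross

variable (p : ι → unitInterval) (e : ι) (U : Fin 3 → Set (Set ι)) (hU : ∀ j, IsUpperSet (U j))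
  (hXC : secAt e false (U 0) ⊆ secAt e true (U 2)) (hYC : secAt e false (U 1) ⊆ secAt e true (U 2))
  (hXY : ex (bernoulliWeight p) (ind (secAt e false (U 0) ∩ secAt e false (U 1)))
    = ex (bernoulliWeight p) (ind (secAt e false (U 0))) * ex (bernoulliWeight p) (ind (secAt e false (U 1))))
include hU hXC hYC hXY

/-- **`E₃(U^{e←1}) ≤ mixC2(U^{e←0}, U^{e←1})`** for an increasing triple whose `0`-sections `X, Y` are independent at `μ_p` and
contained in the `1`-section `C` of the third member (nothing assumed on the `0`-section `G`): the identity above, THEOREM F for `(A,B,C)`,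
Harris and cell bookkeeping. [this work] -/
theorem sahiE_secAt_true_le_mixC2_cross :
    sahiE (bernoulliWeight p) 3 (fun j => ind (secAt e true (U j)))
      ≤ mixC2 (bernoulliWeight p) (fun j => secAt e false (U j)) (fun j => secAt e true (U j)) := by
  have hF := SahiFCombBridge.fIneq_nonneg p (secAt e true (U 0)) (secAt e true (U 1)) (secAt e true (U 2))
    (isUpperSet_secAt e true (hU 0)) (isUpperSet_secAt e true (hU 1)) (isUpperSet_secAt e true (hU 2))
  set m := bernoulliWeight p with hm
  set X := secAt e false (U 0); set Y := secAt e false (U 1); set G := secAt e false (U 2)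
  set A := secAt e true (U 0); set B := secAt e true (U 1); set C := secAt e true (U 2)
  have hXu : IsUpperSet X := isUpperSet_secAt e false (hU 0)
  have hYu : IsUpperSet Y := isUpperSet_secAt e false (hU 1)
  have hGu : IsUpperSet G := isUpperSet_secAt e false (hU 2)
  have hAu : IsUpperSet A := isUpperSet_secAt e true (hU 0)
  have hBu : IsUpperSet B := isUpperSet_secAt e true (hU 1)
  have sA : X ⊆ A := RigidityAll.secAt_false_subset_secAt_true e (hU 0)
  have sB : Y ⊆ B := RigidityAll.secAt_false_subset_secAt_true e (hU 1)
  have sC : G ⊆ C := RigidityAll.secAt_false_subset_secAt_true e (hU 2)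
  have h1 : ex m (ind X * ind Y) = ex m (ind X) * ex m (ind Y) := by rw [ind_mul_ind_eq_inter]; exact hXY
  have hId := mixC2_sub_sahiE_eq_F_add_cross m (fun j => secAt e false (U j)) (fun j => secAt e true (U j)) h1
  simp only [ind_mul_ind_eq_inter] at hId
  -- (i) the product of the two nonnegative differences
  have sAC : X ⊆ A ∩ C := fun ω hω => Set.mem_inter (sA hω) (hXC hω)
  have sBC : Y ⊆ B ∩ C := fun ω hω => Set.mem_inter (sB hω) (hYC hω)
  have tAC : 0 ≤ ex m (ind (A ∩ C)) - ex m (ind X) := by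
    rw [ex_ind_sub_of_subset _ sAC]; exact ex_ind_nonneg' p _
  have tBC : 0 ≤ ex m (ind (B ∩ C)) - ex m (ind Y) := by
    rw [ex_ind_sub_of_subset _ sBC]; exact ex_ind_nonneg' p _
  have tprod := mul_nonneg tAC tBC
  -- (ii) the bracket: cell inside `C` plus two Harris covariances
  have tc : 0 ≤ 1 - ex m (ind C) := by rw [one_sub_ex_ind p C]; exact ex_ind_nonneg' p _
  have tcell : 0 ≤ ex m (ind (C ∩ A ∩ B)) - ex m (ind (C ∩ A ∩ Y)) - ex m (ind (C ∩ X ∩ B)) + ex m (ind (C ∩ X ∩ Y)) := by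
    rw [← cell_inter_sdiff_sdiff m C sA sB]; exact ex_ind_nonneg' p _
  have eCXY : C ∩ X ∩ Y = X ∩ Y := by
    rw [show C ∩ X ∩ Y = X ∩ Y ∩ C by ac_rfl]; exact Set.inter_eq_left.mpr (fun ω hω => hXC hω.1)
  have e1 : C ∩ A ∩ B = A ∩ B ∩ C := by ac_rfl
  have e2 : C ∩ A ∩ Y = A ∩ Y := by
    rw [show C ∩ A ∩ Y = A ∩ (Y ∩ C) by ac_rfl, Set.inter_eq_left.mpr hYC]
  have e3 : C ∩ X ∩ B = X ∩ B := by
    rw [show C ∩ X ∩ B = (X ∩ C) ∩ B by ac_rfl, Set.inter_eq_left.mpr hXC]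
  rw [e1, e2, e3, eCXY] at tcell
  have tXB : 0 ≤ ex m (ind (X ∩ B)) - ex m (ind X) * ex m (ind B) := cov_ind_nonneg p hXu hBu
  have tAY : 0 ≤ ex m (ind (A ∩ Y)) - ex m (ind A) * ex m (ind Y) := cov_ind_nonneg p hAu hYu
  have hXY' : ex m (ind (X ∩ Y)) = ex m (ind X) * ex m (ind Y) := hXY
  have tbr : 0 ≤ ex m (ind (A ∩ B ∩ C)) + ex m (ind X) * ex m (ind Y)
      - ex m (ind X) * ex m (ind B) - ex m (ind Y) * ex m (ind A) := by linarith [tcell, tXB, tAY, hXY']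
  have t2 := mul_nonneg tc tbr
  -- (iii) `(c − g)·Cov(A,B)`
  have tAB : 0 ≤ ex m (ind (A ∩ B)) - ex m (ind A) * ex m (ind B) := cov_ind_nonneg p hAu hBu
  have tCG : 0 ≤ ex m (ind C) - ex m (ind G) := by
    rw [ex_ind_sub_of_subset _ sC]; exact ex_ind_nonneg' p _
  have t3 := mul_nonneg tCG tAB
  -- (iv) the last line: `b(x − m(XG)) + a(y − m(YG)) − 2(xy − m(XYG)) ≥ 0`
  have tby : ex m (ind Y) ≤ ex m (ind B) := by
    have := ex_ind_sub_of_subset m sB; linarith [ex_ind_nonneg' p (B \ Y), this]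
  have tax : ex m (ind X) ≤ ex m (ind A) := by
    have := ex_ind_sub_of_subset m sA; linarith [ex_ind_nonneg' p (A \ X), this]
  have txg : ex m (ind (X ∩ G)) ≤ ex m (ind X) := by
    have := ex_ind_sub_of_subset m (Set.inter_subset_left : X ∩ G ⊆ X); linarith [ex_ind_nonneg' p (X \ (X ∩ G)), this]
  have tyg : ex m (ind (Y ∩ G)) ≤ ex m (ind Y) := by
    have := ex_ind_sub_of_subset m (Set.inter_subset_left : Y ∩ G ⊆ Y); linarith [ex_ind_nonneg' p (Y \ (Y ∩ G)), this]
  have tH1 : ex m (ind (X ∩ G)) * ex m (ind Y) ≤ ex m (ind (X ∩ Y ∩ G)) := by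
    have h := harris_ex_ind p (hXu.inter hGu) hYu
    rwa [show X ∩ G ∩ Y = X ∩ Y ∩ G by ac_rfl] at h
  have tH2 : ex m (ind X) * ex m (ind (Y ∩ G)) ≤ ex m (ind (X ∩ Y ∩ G)) := by
    have h := harris_ex_ind p hXu (hYu.inter hGu)
    rwa [show X ∩ (Y ∩ G) = X ∩ Y ∩ G by ac_rfl] at h
  have t4 : 0 ≤ ex m (ind B) * (ex m (ind X) - ex m (ind (X ∩ G))) + ex m (ind A) * (ex m (ind Y) - ex m (ind (Y ∩ G)))
      - 2 * (ex m (ind X) * ex m (ind Y) - ex m (ind (X ∩ Y ∩ G))) := by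
    have p1 := mul_nonneg (sub_nonneg.2 tby) (sub_nonneg.2 txg)
    have p2 := mul_nonneg (sub_nonneg.2 tax) (sub_nonneg.2 tyg)
    linarith [p1, p2, tH1, tH2]
  have hgoal : 0 ≤ mixC2 m (fun j => secAt e false (U j)) (fun j => secAt e true (U j))
      - sahiE m 3 (fun j => ind (secAt e true (U j))) := by
    rw [hId]; linarith [t2, tprod, t3, t4, hF]
  linarith [hgoal]

/-- **Cross-absorbed triples DOMINATE THEIR `e`-MINORS** (the hypothesis of gen 15's class theorem
`sahiE_ind_nonneg_and_eq_zero_iff_on_class_of_minorDomination`, with the explicit constants `(1−p_e)², p_e²`): for an increasing triple `U`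
with `μ_p(X∩Y) = μ_pX·μ_pY` and `X ∪ Y ⊆ C` and an interior `p_e`, there are `c₀, c₁ > 0` with
`c₀·E₃(μ_p;U^{e←0}) + c₁·E₃(μ_p;U^{e←1}) ≤ E₃(μ_p;U)`. [this work] -/
theorem dominatesMinors_cross (hpe : (p e : ℝ) ∈ Set.Ioo (0 : ℝ) 1) :
    ∃ c₀ c₁ : ℝ, 0 < c₀ ∧ 0 < c₁ ∧
      c₀ * sahiE (bernoulliWeight p) 3 (fun j => ind (secAt e false (U j)))
        + c₁ * sahiE (bernoulliWeight p) 3 (fun j => ind (secAt e true (U j)))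
        ≤ sahiE (bernoulliWeight p) 3 (fun j => ind (U j)) := by
  refine ⟨(1 - (p e : ℝ)) ^ 2, (p e : ℝ) ^ 2, by nlinarith [hpe.2], by nlinarith [hpe.1], ?_⟩
  exact sahiE_three_ge_sq_minors_of_mixC2_ge e U hU p (sahiE_secAt_true_le_mixC2_cross p e U hU hXC hYC hXY)

omit hXC hYC in
/-- The `0`-minor of a cross-absorbed triple is an independent-pair triple: `E₃(X,Y,G) = Cov(X∩G,Y) + Cov(Y∩G,X) ≥ 0`. [this work] -/
theorem sahiE_three_secAt_false_nonneg_cross :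
    0 ≤ sahiE (bernoulliWeight p) 3 (fun j => ind (secAt e false (U j))) := by
  set m := bernoulliWeight p with hm
  set X := secAt e false (U 0); set Y := secAt e false (U 1); set G := secAt e false (U 2)
  have hXu : IsUpperSet X := isUpperSet_secAt e false (hU 0)
  have hYu : IsUpperSet Y := isUpperSet_secAt e false (hU 1)
  have hGu : IsUpperSet G := isUpperSet_secAt e false (hU 2)
  have hv : (fun j => ind (secAt e false (U j))) = ![ind X, ind Y, ind G] := by
    funext j; fin_cases j <;> rfl
  rw [hv, sahiE_three, ind_mul_ind_eq_inter, ind_mul_ind_eq_inter, ind_mul_ind_eq_inter, ind_mul_ind_eq_inter]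
  have hXY' : ex m (ind (X ∩ Y)) = ex m (ind X) * ex m (ind Y) := hXY
  have tH1 : ex m (ind (X ∩ G)) * ex m (ind Y) ≤ ex m (ind (X ∩ Y ∩ G)) := by
    have h := harris_ex_ind p (hXu.inter hGu) hYu
    rwa [show X ∩ G ∩ Y = X ∩ Y ∩ G by ac_rfl] at h
  have tH2 : ex m (ind X) * ex m (ind (Y ∩ G)) ≤ ex m (ind (X ∩ Y ∩ G)) := by
    have h := harris_ex_ind p hXu (hYu.inter hGu)
    rwa [show X ∩ (Y ∩ G) = X ∩ Y ∩ G by ac_rfl] at h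
  rw [hXY']
  linarith [tH1, tH2]

/-- **Settledness transfer for cross-absorbed triples** (closed parameter `p_e ∈ [0,1]` for positivity, `p_e ≠ 0` for the zero half):
if the `1`-minor has `E₃ ≥ 0` then `E₃(μ_p;U) ≥ 0`, and if moreover `p_e ≠ 0` and `E₃(μ_p;U) = 0` then `E₃(μ_p;U^{e←1}) = 0`
(the `0`-minor is an independent-pair triple, `sahiE_three_secAt_false_nonneg_cross`). [this work] -/
theorem sahiE_three_nonneg_and_secAt_true_eq_zero_cross
    (h1 : 0 ≤ sahiE (bernoulliWeight p) 3 (fun j => ind (secAt e true (U j)))) :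
    0 ≤ sahiE (bernoulliWeight p) 3 (fun j => ind (U j)) ∧
      ((p e : ℝ) ≠ 0 → sahiE (bernoulliWeight p) 3 (fun j => ind (U j)) = 0 →
        sahiE (bernoulliWeight p) 3 (fun j => ind (secAt e true (U j))) = 0) := by
  have h := sahiE_three_ge_sq_minors_of_mixC2_ge e U hU p (sahiE_secAt_true_le_mixC2_cross p e U hU hXC hYC hXY)
  have hz := sahiE_three_secAt_false_nonneg_cross p e U hU hXY
  refine ⟨by nlinarith [mul_nonneg (sq_nonneg (1 - (p e : ℝ))) hz, mul_nonneg (sq_nonneg (p e : ℝ)) h1], fun hpe h0 => ?_⟩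
  rw [h0] at h
  have hsq : 0 < (p e : ℝ) ^ 2 := by positivity
  nlinarith [mul_nonneg (sq_nonneg (1 - (p e : ℝ))) hz, mul_nonneg (le_of_lt hsq) h1]

end Cross


/-! ### 3. (gen 30 append) No independence: the common part `X ∩ Y` absorbed by the third member's `0`-section

`mixC2_sub_sahiE_eq_master` is the identity with NO hypotheses; `sahiE_secAt_true_le_mixC2_of_absorbed` / `dominatesMinors_of_absorbed`:
**minor domination at `(U,e)` for every increasing triple with `U₀⁰ ∪ U₁⁰ ⊆ U₂¹` and `U₀⁰ ∩ U₁⁰ ⊆ U₂⁰`** — no independence, no zero flag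
(e.g. `U₀⁰ ⊆ U₂⁰` and `U₁⁰ ⊆ U₂¹`; or the D0 core of gen 20 without its independence hypothesis).  Numerics first:
`prim-master-conj/code-g30/d0alpha.py`, `d0dep.py` (identity exact, 0 mismatches; `Λ ≥ 0`). [this work] -/

section Master

variable (μ : Set ι → ℝ) (P Q : Fin 3 → Set (Set ι))

/-- **The MASTER identity, no hypotheses at all** (pure algebra on the 14 moments):
`Λ = F(A,B;C) + (m(AC)−x)(m(BC)−y) + (1−c)[m(ABC)+xy−xb−ya] + (c−g)(m(AB)−ab) + b(x−m(XG)) + a(y−m(YG)) − 2(xy−m(XYG)) − c(m(XY)−xy)`. [this work] -/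
theorem mixC2_sub_sahiE_eq_master :
    mixC2 μ P Q - sahiE μ 3 (fun j => ind (Q j))
      = ((1 + ex μ (ind (Q 2))) * ex μ (ind (Q 0) * ind (Q 1) * ind (Q 2))
            - ex μ (ind (Q 2)) * ex μ (ind (Q 0) * ind (Q 1))
            - ex μ (ind (Q 0) * ind (Q 2)) * ex μ (ind (Q 1) * ind (Q 2)))
        + (ex μ (ind (Q 0) * ind (Q 2)) - ex μ (ind (P 0))) * (ex μ (ind (Q 1) * ind (Q 2)) - ex μ (ind (P 1)))
        + (1 - ex μ (ind (Q 2))) * (ex μ (ind (Q 0) * ind (Q 1) * ind (Q 2)) + ex μ (ind (P 0)) * ex μ (ind (P 1))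
            - ex μ (ind (P 0)) * ex μ (ind (Q 1)) - ex μ (ind (P 1)) * ex μ (ind (Q 0)))
        + (ex μ (ind (Q 2)) - ex μ (ind (P 2))) * (ex μ (ind (Q 0) * ind (Q 1)) - ex μ (ind (Q 0)) * ex μ (ind (Q 1)))
        + (ex μ (ind (Q 1)) * (ex μ (ind (P 0)) - ex μ (ind (P 0) * ind (P 2)))
            + ex μ (ind (Q 0)) * (ex μ (ind (P 1)) - ex μ (ind (P 1) * ind (P 2)))
            - 2 * (ex μ (ind (P 0)) * ex μ (ind (P 1)) - ex μ (ind (P 0) * ind (P 1) * ind (P 2))))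
        - ex μ (ind (Q 2)) * (ex μ (ind (P 0) * ind (P 1)) - ex μ (ind (P 0)) * ex μ (ind (P 1))) := by
  rw [mixC2, sahiE_three_apply]
  ring

end Master

section Absorbed

variable (p : ι → unitInterval) (e : ι) (U : Fin 3 → Set (Set ι)) (hU : ∀ j, IsUpperSet (U j))
  (hXC : secAt e false (U 0) ⊆ secAt e true (U 2)) (hYC : secAt e false (U 1) ⊆ secAt e true (U 2))
  (hXYG : secAt e false (U 0) ∩ secAt e false (U 1) ⊆ secAt e false (U 2))
include hU hXC hYC hXYG

/-- **`E₃(U^{e←1}) ≤ mixC2(U^{e←0}, U^{e←1})` with NO independence**: for an increasing triple `U` whose `0`-sections `X, Y` of the first two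
members lie in the `1`-section `C` of the third and whose common part `X ∩ Y` lies in its `0`-section `G`.  With `X ∩ Y ⊆ G` the master
identity's tail `b·μ(X∖G) + a·μ(Y∖G) − 2(xy − m(XYG)) − c(m(XY) − xy) − (1−c)(m(XY) − xy)` collapses to `b·μ(X∖G) + a·μ(Y∖G) + Cov(X,Y) ≥ 0`;
the rest is THEOREM F, a cell inside `C`, and Harris. [this work] -/
theorem sahiE_secAt_true_le_mixC2_of_absorbed :
    sahiE (bernoulliWeight p) 3 (fun j => ind (secAt e true (U j)))
      ≤ mixC2 (bernoulliWeight p) (fun j => secAt e false (U j)) (fun j => secAt e true (U j)) := by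
  have hF := SahiFCombBridge.fIneq_nonneg p (secAt e true (U 0)) (secAt e true (U 1)) (secAt e true (U 2))
    (isUpperSet_secAt e true (hU 0)) (isUpperSet_secAt e true (hU 1)) (isUpperSet_secAt e true (hU 2))
  set m := bernoulliWeight p with hm
  set X := secAt e false (U 0); set Y := secAt e false (U 1); set G := secAt e false (U 2)
  set A := secAt e true (U 0); set B := secAt e true (U 1); set C := secAt e true (U 2)
  have hXu : IsUpperSet X := isUpperSet_secAt e false (hU 0)
  have hYu : IsUpperSet Y := isUpperSet_secAt e false (hU 1)
  have hAu : IsUpperSet A := isUpperSet_secAt e true (hU 0)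
  have hBu : IsUpperSet B := isUpperSet_secAt e true (hU 1)
  have sA : X ⊆ A := RigidityAll.secAt_false_subset_secAt_true e (hU 0)
  have sB : Y ⊆ B := RigidityAll.secAt_false_subset_secAt_true e (hU 1)
  have sC : G ⊆ C := RigidityAll.secAt_false_subset_secAt_true e (hU 2)
  have hId := mixC2_sub_sahiE_eq_master m (fun j => secAt e false (U j)) (fun j => secAt e true (U j))
  simp only [ind_mul_ind_eq_inter] at hId
  -- (i) product of nonnegative differences
  have sAC : X ⊆ A ∩ C := fun ω hω => Set.mem_inter (sA hω) (hXC hω)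
  have sBC : Y ⊆ B ∩ C := fun ω hω => Set.mem_inter (sB hω) (hYC hω)
  have tAC : 0 ≤ ex m (ind (A ∩ C)) - ex m (ind X) := by
    rw [ex_ind_sub_of_subset _ sAC]; exact ex_ind_nonneg' p _
  have tBC : 0 ≤ ex m (ind (B ∩ C)) - ex m (ind Y) := by
    rw [ex_ind_sub_of_subset _ sBC]; exact ex_ind_nonneg' p _
  have tprod := mul_nonneg tAC tBC
  -- (ii) bracket: cell inside `C` and two Harris covariances (the `Cov(X,Y)` part is handled in (iv))
  have tc : 0 ≤ 1 - ex m (ind C) := by rw [one_sub_ex_ind p C]; exact ex_ind_nonneg' p _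
  have tcell : 0 ≤ ex m (ind (C ∩ A ∩ B)) - ex m (ind (C ∩ A ∩ Y)) - ex m (ind (C ∩ X ∩ B)) + ex m (ind (C ∩ X ∩ Y)) := by
    rw [← cell_inter_sdiff_sdiff m C sA sB]; exact ex_ind_nonneg' p _
  have eCXY : C ∩ X ∩ Y = X ∩ Y := by
    rw [show C ∩ X ∩ Y = X ∩ Y ∩ C by ac_rfl]; exact Set.inter_eq_left.mpr (fun ω hω => hXC hω.1)
  have e1 : C ∩ A ∩ B = A ∩ B ∩ C := by ac_rfl
  have e2 : C ∩ A ∩ Y = A ∩ Y := by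
    rw [show C ∩ A ∩ Y = A ∩ (Y ∩ C) by ac_rfl, Set.inter_eq_left.mpr hYC]
  have e3 : C ∩ X ∩ B = X ∩ B := by
    rw [show C ∩ X ∩ B = (X ∩ C) ∩ B by ac_rfl, Set.inter_eq_left.mpr hXC]
  rw [e1, e2, e3, eCXY] at tcell
  have tXB : 0 ≤ ex m (ind (X ∩ B)) - ex m (ind X) * ex m (ind B) := cov_ind_nonneg p hXu hBu
  have tAY : 0 ≤ ex m (ind (A ∩ Y)) - ex m (ind A) * ex m (ind Y) := cov_ind_nonneg p hAu hYu
  have tbr : 0 ≤ ex m (ind (A ∩ B ∩ C)) + ex m (ind (X ∩ Y))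
      - ex m (ind X) * ex m (ind B) - ex m (ind Y) * ex m (ind A) := by linarith [tcell, tXB, tAY]
  have t2 := mul_nonneg tc tbr
  -- (iii) `(c − g)·Cov(A,B)`
  have tAB : 0 ≤ ex m (ind (A ∩ B)) - ex m (ind A) * ex m (ind B) := cov_ind_nonneg p hAu hBu
  have tCG : 0 ≤ ex m (ind C) - ex m (ind G) := by
    rw [ex_ind_sub_of_subset _ sC]; exact ex_ind_nonneg' p _
  have t3 := mul_nonneg tCG tAB
  -- (iv) the tail: `b·μ(X∖G) + a·μ(Y∖G) + Cov(X,Y)` (using `X ∩ Y ⊆ G`)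
  have tb : 0 ≤ ex m (ind B) := ex_ind_nonneg' p _
  have ta : 0 ≤ ex m (ind A) := ex_ind_nonneg' p _
  have txg : 0 ≤ ex m (ind X) - ex m (ind (X ∩ G)) := by
    rw [ex_ind_sub_of_subset m (Set.inter_subset_left : X ∩ G ⊆ X)]; exact ex_ind_nonneg' p _
  have tyg : 0 ≤ ex m (ind Y) - ex m (ind (Y ∩ G)) := by
    rw [ex_ind_sub_of_subset m (Set.inter_subset_left : Y ∩ G ⊆ Y)]; exact ex_ind_nonneg' p _
  have t4 := mul_nonneg tb txg
  have t5 := mul_nonneg ta tyg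
  have eXYG : X ∩ Y ∩ G = X ∩ Y := Set.inter_eq_left.mpr hXYG
  have tXY : ex m (ind X) * ex m (ind Y) ≤ ex m (ind (X ∩ Y)) := harris_ex_ind p hXu hYu
  have hgoal : 0 ≤ mixC2 m (fun j => secAt e false (U j)) (fun j => secAt e true (U j))
      - sahiE m 3 (fun j => ind (secAt e true (U j))) := by
    rw [hId, eXYG]; linarith [t2, tprod, t3, t4, t5, tXY, hF]
  linarith [hgoal]

/-- **Minor domination with no independence**: for an increasing triple `U` with `U₀⁰ ∪ U₁⁰ ⊆ U₂¹` and `U₀⁰ ∩ U₁⁰ ⊆ U₂⁰` and an interior `p_e`,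
`U` dominates its `e`-minors with constants `(1−p_e)², p_e²`.  In particular for `U₀⁰ ⊆ U₂⁰, U₁⁰ ⊆ U₂¹` ("one side absorbed early, the other late"),
and for the D0 core without its independence hypothesis. [this work] -/
theorem dominatesMinors_of_absorbed (hpe : (p e : ℝ) ∈ Set.Ioo (0 : ℝ) 1) :
    ∃ c₀ c₁ : ℝ, 0 < c₀ ∧ 0 < c₁ ∧
      c₀ * sahiE (bernoulliWeight p) 3 (fun j => ind (secAt e false (U j)))
        + c₁ * sahiE (bernoulliWeight p) 3 (fun j => ind (secAt e true (U j)))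
        ≤ sahiE (bernoulliWeight p) 3 (fun j => ind (U j)) := by
  refine ⟨(1 - (p e : ℝ)) ^ 2, (p e : ℝ) ^ 2, by nlinarith [hpe.2], by nlinarith [hpe.1], ?_⟩
  exact sahiE_three_ge_sq_minors_of_mixC2_ge e U hU p (sahiE_secAt_true_le_mixC2_of_absorbed p e U hU hXC hYC hXYG)

/-- **Two-sided transfer with no independence**: under the same hypotheses, if both `e`-minors have `E₃ ≥ 0` then `E₃(μ_p;U) ≥ 0`, and at an
interior `p_e` a zero of `U` is a zero of both minors. [this work] -/
theorem sahiE_three_nonneg_and_minors_eq_zero_of_absorbed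
    (h0 : 0 ≤ sahiE (bernoulliWeight p) 3 (fun j => ind (secAt e false (U j))))
    (h1 : 0 ≤ sahiE (bernoulliWeight p) 3 (fun j => ind (secAt e true (U j)))) :
    0 ≤ sahiE (bernoulliWeight p) 3 (fun j => ind (U j)) ∧
      ((p e : ℝ) ∈ Set.Ioo (0 : ℝ) 1 → sahiE (bernoulliWeight p) 3 (fun j => ind (U j)) = 0 →
        sahiE (bernoulliWeight p) 3 (fun j => ind (secAt e false (U j))) = 0 ∧
          sahiE (bernoulliWeight p) 3 (fun j => ind (secAt e true (U j))) = 0) := by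
  have h := sahiE_three_ge_sq_minors_of_mixC2_ge e U hU p (sahiE_secAt_true_le_mixC2_of_absorbed p e U hU hXC hYC hXYG)
  refine ⟨by nlinarith [mul_nonneg (sq_nonneg (1 - (p e : ℝ))) h0, mul_nonneg (sq_nonneg (p e : ℝ)) h1], fun hpe hz => ?_⟩
  rw [hz] at h
  have hs : 0 < (1 - (p e : ℝ)) ^ 2 := by nlinarith [hpe.2]
  have ht : 0 < (p e : ℝ) ^ 2 := by nlinarith [hpe.1]
  constructor
  · nlinarith [mul_nonneg (le_of_lt hs) h0, mul_nonneg (le_of_lt ht) h1]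
  · nlinarith [mul_nonneg (le_of_lt hs) h0, mul_nonneg (le_of_lt ht) h1]

end Absorbed

end Pointwise

end Summit.CriticalPhenomena.PercolationContinuityZ3.Theorems
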